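import Summits.ABC.IUTFork.Joshi.ATS4ExistenceLemmas
import Summits.ABC.IUTFork.Joshi.ATS4InitialThetaDataExistence
import Literature.IUT.LogVolume.LambdaLineGaloisDegree
import HarnessLib

/-!
# [J-IV] §5.8 running datum «Q = Tate(C_λ) = Σ_v a_v·f_v·log(p_v)» AT THE POINT `λ` — merge of the interim carrier `TateDatum` (E-t29,
# `ATS4ExistenceLemmas.lean`) with Def. 5.4.1's `Tate` (E-t28, `ATS4InitialThetaDataExistence.lean`)

Bridge file of the abc-iut cell, block E (rung LADDER-ABC:A2.E; seat abc-iut-E-t28; closes the §3 merge-debt T-28 ↔ T-29 of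
`HOME/plan/E/ASSIGNMENTS.md`: «TateDatum (interim carrier; merge-debt: J4:Def5.4.1 `Tate`, J4:Thm5.7.1 = slot T-28)»). SOURCE: K. Joshi, *Construction of
Arithmetic Teichmüller Spaces IV*, arXiv:2403.10430v2 (UNREFEREED) = [J-IV], §5.8 p.54 l.9–17 («In what follows, write `Q = Tate(C_λ) = Σ_{v ∈ V_L}
a_v·log(v) = Σ_{v ∈ V_L} a_v·f_v·log(p_v)` with `a_v ∈ ℤ_{≥0}`») and Thm. 5.7.1 p.53 l.35–36 («`δ = d*_mod`»). TAKES NO SIDE on anything disputed;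
classical bookkeeping only.

`TateDatum.ofPoint λ`: the places `v` = the poles of `j(λ)` over `ℚ(λ)` (`Cor22.badPlaces`; = `tateSupport [C_λ]`), `a_v = ord_v(q_v) = max(0,
−ord_v(j(λ)))` (= `tateOrd [C_λ] v`, Def. 5.4.1), `f_v`, `p_v` the residue degree / characteristic, `[L:ℚ] := [ℚ(λ):ℚ]` (READING: Joshi's `L` is
the field `L_mod(√−1, C_λ[2·3·5])`; the normalized `Q` is the same over every finite extension — [J-IV] Prop. 4.4.4, tree
`Cor22`/`TateDivisorDatum.prop444_ofNFPoint` — and Lem. 5.8.2's estimates only use `[L:ℚ] ≤ δ`, true for either choice), `δ := d*_mod(λ)`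
(`deltaMod`), `Q := Tate(C_λ)` (= `Cor22.logQForall λ` by Rmk. 5.4.3 / `tate_legendrePt`). PROVED: the defining identity `[L:ℚ]·Q = Σ a_v f_v log p_v`
(tree `Cor22.degree_mul_logQForall_eq_sum`), `[ℚ(λ):ℚ] ≤ 6·d_mod ≤ δ` (`Cor22.degree_le_six_mul_dmod`), and hence **Lemma 5.8.7 for the curve `C_λ`
with Joshi's `δ`** (`lem587_ofPoint`, from E-t29's `TateDatum.lem587_holds`) — the prime-choice input of T-28's discharge of Thm. 5.7.1
(`ATS4InitialThetaDataExistenceProofs.lean`, there fed to `Cor22.PrimeChoiceData` directly; the two routes coincide: `toPrimeChoiceData_ofPoint`).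
[claim: Joshi2024ATS4, status: disputed]
-/

noncomputable section

open scoped Classical
open NumberField IsDedekindDomain
open Literature.NumberTheory.DiophantineGeometry.GenEll Literature.IUT.LogVolume

namespace Summit.ABC.IUTFork.Joshi.ATS4

namespace TateDatum

/-- **[J-IV] §5.8 running datum at the point `λ ∈ U`** (p.54 l.9–17 with Thm. 5.7.1's `δ = d*_mod`, p.53 l.35–36): `V` = poles of `j(λ)`, `a_v =
max(0, −ord_v(j(λ)))` (Def. 5.4.1's `ord_v(q_v)`), `f_v`, `p_v`, `[L:ℚ] := [ℚ(λ):ℚ]` (reading, see the module docstring), `δ := d*_mod(λ)`, `Q :=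
Tate(C_λ) = Cor22.logQForall λ`. [claim: Joshi2024ATS4, status: disputed] -/
def ofPoint (P : NFPoint) (hP : P ∈ UP) : TateDatum where
  ι := HeightOneSpectrum (𝓞 P.F)
  V := Cor22.badPlaces P
  a := fun v => (-(ord P.F v (Cor22.jInv P.x))).toNat
  f := resDeg P.F
  one_le_f := fun v _ => Nat.one_le_iff_ne_zero.mpr (resDeg_ne_zero P.F v)
  p := residueChar P.F
  p_prime := fun v _ => residueChar_prime P.F v
  degL := P.degree
  one_le_degL := P.degree_pos
  δ := deltaMod P
  two_le_δ := by
    have h : (1 : ℝ) ≤ Cor22.dmod P := by exact_mod_cast Cor22.dmod_pos P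
    rw [deltaMod_eq]; nlinarith
  degL_le_δ := by
    have h6 : (P.degree : ℝ) ≤ 6 * (Cor22.dmod P : ℝ) := by exact_mod_cast Cor22.degree_le_six_mul_dmod P hP
    have h0 : (0 : ℝ) ≤ Cor22.dmod P := Nat.cast_nonneg _
    rw [deltaMod_eq]; nlinarith
  Q := Cor22.logQForall P
  Q_def := Cor22.degree_mul_logQForall_eq_sum P

variable (P : NFPoint) (hP : P ∈ UP)

/-- `Q = Tate(C_λ)` (Def. 5.4.1 at the Legendre curve, T-28's `tate`; Rmk. 5.4.3). PROVED. [claim: Joshi2024ATS4, status: disputed] -/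
theorem ofPoint_Q : (ofPoint P hP).Q = tate (legendrePt P hP.1) := (tate_legendrePt P hP.1).symm

/-- `a_v = ord_v(q_v)` of Def. 5.4.1 at `C_λ` (T-28's `tateOrd`). PROVED. [claim: Joshi2024ATS4, status: disputed] -/
theorem ofPoint_a (v : HeightOneSpectrum (𝓞 P.F)) : (ofPoint P hP).a v = tateOrd (legendrePt P hP.1) v := by
  haveI := Cor22.isElliptic_legendre P hP.1
  show (-(ord P.F v (Cor22.jInv P.x))).toNat =
    (-(ord P.F v (WeierstrassCurve.j (⟨0, -(1 + P.x), 0, P.x, 0⟩ : WeierstrassCurve P.F)))).toNat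
  rw [Cor22.j_legendre P hP.1]

/-- The places of the datum are T-28's `tateSupport [C_λ]` (poles of `j(λ)`). PROVED. [claim: Joshi2024ATS4, status: disputed] -/
theorem ofPoint_V : (ofPoint P hP).V = tateSupport (legendrePt P hP.1) := by
  haveI := Cor22.isElliptic_legendre P hP.1
  show Cor22.badPlaces P = (HeightOneSpectrum.Support.finite (R := 𝓞 P.F)
    (WeierstrassCurve.j (⟨0, -(1 + P.x), 0, P.x, 0⟩ : WeierstrassCurve P.F))).toFinset
  rw [Cor22.j_legendre P hP.1]
  rfl

/-- `δ = d*_mod(λ)` (T-28's `deltaMod`, E-t26's `dStarMod` at `L_mod = ℚ(j_λ)`). PROVED (`rfl`). [claim: Joshi2024ATS4, status: disputed] -/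
theorem ofPoint_δ : (ofPoint P hP).δ = deltaMod P := rfl

/-- The two dictionaries to [IUTchIV] agree: E-t29's `toPrimeChoiceData` of the point datum has the same fields `(V, h_v, f_v, p_v, d, δ, h)` as the
`Cor22.PrimeChoiceData` T-28 builds in `thm571With_conditions_of_fullGaloisImage`. PROVED (`rfl` on each field). [claim: Joshi2024ATS4, status: disputed] -/
theorem toPrimeChoiceData_ofPoint {ξ : ℝ} (hξ : IsXiPrm ξ) (hξQ : ξ ≤ Real.sqrt (ofPoint P hP).Q) :
    ((ofPoint P hP).toPrimeChoiceData ξ hξ hξQ).h = Cor22.logQForall P ∧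
      ((ofPoint P hP).toPrimeChoiceData ξ hξ hξQ).δ = deltaMod P ∧ ((ofPoint P hP).toPrimeChoiceData ξ hξ hξQ).d = P.degree :=
  ⟨rfl, rfl, rfl⟩

/-- **[J-IV] Lemma 5.8.7 for the curve `C_λ`, with Joshi's `δ = d*_mod(λ)`**: under the running hypothesis «`Q^{1/2} ≥ ξ_prm`» (p.54 l.27–28) there is a
prime `ℓ` with (1) `Q^{1/2} ≤ ℓ ≤ 10·δ·Q^{1/2}·log(2·δ·Q)`, (2) `ℓ ∤ a_v` (`a_v ≠ 0`), (3) `a_v < Q^{1/2}` if `p_v = ℓ` — E-t29's `lem587_holds` at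
`ofPoint λ`. PROVED. [claim: Joshi2024ATS4, status: disputed] -/
theorem lem587_ofPoint {ξ : ℝ} (hξ : IsXiPrm ξ) (hξQ : ξ ≤ Real.sqrt (Cor22.logQForall P)) : ∃ ℓ : ℕ, (ofPoint P hP).Lem587Concl ℓ :=
  (ofPoint P hP).lem587_holds ξ hξ hξQ

/-- Lemma 5.8.7 (1) at `C_λ` is exactly T-28's `lem587Window λ ℓ`. PROVED. [claim: Joshi2024ATS4, status: disputed] -/
theorem lem587Window_of_concl {ℓ : ℕ} (h : (ofPoint P hP).Lem587Concl ℓ) : lem587Window P ℓ := h.2.1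

end TateDatum

end Summit.ABC.IUTFork.Joshi.ATS4

end
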